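import Summits.Langlands.Langlands.Theorems.MonomialSerreAtSplitPrimes.Negative.FalseOfCubicField
import Summits.Langlands.Langlands.Theorems.MonomialSerreAtSplitPrimes.Negative.PureCubicTwoSplitData

/-!
# Refutation of `SplitPrimeInduction.MonomialSerreAtSplitPrimes` (stmt-Langlands-16951)

The crux (rank 3 of route `route-Langlands-SplitPrimeInduction`) asserts Serre-type occurrence on
`GL_d/ℚ` of the induced system of EVERY continuous character `χ : Γ_F → k^×`, for every number field `F`
of degree `d ≥ 2` with at most one real place and every odd prime `p` completely split in `F`.  It is
false for `F = ℚ(∛2)` (`d = 3`, `r₁ = 1`), `p = 31`, `k = 𝔽̄₃₁`, `χ = 1`: see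
`Negative.FalseOfCubicField` (mechanism: the Hecke operator of a principal scalar idèle is the identity
on the tree's `H^i(X_K, k)`, the top Hecke operator at a Dirichlet prime `ℓ ≡ -1 (mod 31·M)` is such an
operator up to an element of the open level, so `b_{ℓ,3} = 1`, while the `X³`-coefficient of
`∏_{w∣ℓ}(1 - X^{f_w})` at a prime with splitting type `(1,2)` forces `-ℓ⁶ b_{ℓ,3} = 1`, i.e. `-1 = 1`)
and `Negative.PureCubicTwoSplitData` (the arithmetic of `ℚ(∛2)`: `31` splits completely, primes
`ℓ ≡ 2 (mod 3)` have splitting type `(1,2)`, `r₁ = 1`).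
-/

noncomputable section

set_option linter.dupNamespace false -- `Summit.Langlands.Langlands` is the mandated namespace (D-0017)

open Polynomial
open Summit.Langlands.Langlands.Theorems.MonomialSerreAtSplitPrimes.Negative

namespace Summit.Langlands.Langlands.Theorems

/-- Refutes `SplitPrimeInduction.MonomialSerreAtSplitPrimes` [refuted-misstated]: the crux asserts, for
EVERY continuous character `χ` of `Γ_F` (`F` of degree `d ≥ 2` with `r₁(F) ≤ 1`, `p` odd completely
split, `k` algebraically closed discrete of characteristic `p`), an eigenclass `b` in some
`H^{i'}(X_{K'}, k)` of `GL_d/ℚ` with `P_v(b) = ∏_{w∣v}(1 - c_w⁻¹X^{f_w})` off `S'`; witness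
`F = ℚ(∛2)` (`AdjoinRoot (X³ - 2)`, `d = 3`, one real place), `p = 31` (`x³ - 2 ≡ (x-4)(x-7)(x-20)`),
`k = 𝔽̄₃₁`, `χ = 1`, `Sχ = ∅`, `c ≡ 1`: for a Dirichlet prime `ℓ ≡ -1` modulo `31 · 3 · ∏ q_v^{N_v+1}`
(`v` over the level's finite set and `S'`) the top Hecke operator `T^{(3)}_ℓ` is the identity on the
eigenclass (central sign lemma + openness of `K'`), so `b_{ℓ,3} = 1`, whereas `(ℓ)` has two places of
degrees `1, 2` in `ℚ(∛2)` and the `X³`-coefficient gives `-ℓ⁶ b_{ℓ,3} = 1`, i.e. `-1 = 1` in `𝔽̄₃₁`.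
REPAIRED STATEMENT `C′`: insert `χ.IsOdd →` after the binder `(c : HeightOneSpectrum (𝓞 F) → k)`
(`χ(c_v) = -1` at every real place; vacuous for `r₁ = 0`) — literally the planner's
`Summit.Langlands.Langlands.Cruxes.MonomialSerreAtSplitPrimes.Birth.MonomialSerreAtSplitPrimesOdd`; the
witness `χ = 1` over a field with a real place is even there and MISSES `C′` (for odd `χ` the sign of
the `X³`-coefficient is `χ∘Ver(ℓ)·sgn(Frob_ℓ) = +1·(-1)… = -1`, consistent). [folklore] -/
theorem SplitPrimeInductionMonomialSerreAtSplitPrimes_refuted :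
    ¬ Summit.Langlands.Langlands.Theses.SplitPrimeInduction.MonomialSerreAtSplitPrimes := by
  haveI : Fact (Irreducible (X ^ 3 - C (2 : ℚ) : ℚ[X])) := ⟨irreducible_X_pow_three_sub_two⟩
  obtain ⟨θ, hθ⟩ := exists_theta
  exact monomialSerreAtSplitPrimes_false_of_cubicField (AdjoinRoot (X ^ 3 - C (2 : ℚ)))
    finrank_cubicTwo nrRealPlaces_cubicTwo_le (p := 31) (by norm_num) (by norm_num)
    (split_thirtyone finrank_cubicTwo hθ) (M₀ := 3) (B₀ := 3) (by norm_num)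
    (fun ℓ hℓ hB hdvd v hv => cubicTwo_splitData hθ ℓ hℓ hB hdvd v hv)

end Summit.Langlands.Langlands.Theorems

end
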